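import Summits.QuantumFields.BalabanUV.T4Continuum.Spine.NE2BalabanWiring
import Summits.QuantumFields.BalabanUV.T4Continuum.Support.GaugeTermBalabanData
import Summits.QuantumFields.BalabanUV.T4Continuum.Support.RegularSiteTransportLaws
import Summits.QuantumFields.BalabanUV.T4Continuum.Support.EffectiveLaplacianExcess

/-!
# T⁴ programme, spine node NE2 (U1a), tier B row B7 (ASSEMBLY) — ROOT B FOR BAŁABAN's TYPED OPERATOR ON ROW DATA ONLY:
# every operator-level binder discharged BY NAME; what stays displayed is node NE3, the regularity class and numeric smallness

NE2 formalisation swarm `b2b-balaban-t4-ne2-formalise-*`, leaf prover 08 (row B7 of `t4/formal/NE2/LEAVES.md`, CLAIMS l.5490), PART 2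
file 6.  Inputs, all BY NAME: `Spine/NE2BalabanWiring` (leaf-08: `averagingLaws_Ecov_of_regular`, `epsR`, `CdeltaR`, `thetaR`),
`Spine/NE2BalabanLayerSharp` (leaf-03: `perturbationLaws_balaban_sharp`, `balaban_rate_of_small_sharp`, `KstarR`),
`Support/GaugeTermBalabanData` (leaf-05 GEN 2, row B4.b: `perturbationLaws_gaugeSlot_data` — row B4.e's END
`ScalarCovariantLaplacianLaws.perturbationLaws_scalarLayer` (leaf-01) inside), `Support/EffectiveLaplacianExcess` (leaf-04, row B4.d END
`freeTowerLaws_king_scalar`, HYPOTHESIS-FREE), `Support/RegularSiteTransporters` / `Support/RegularSiteTransportLaws` (leaf-03, rows B5 ×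
B3.b-conc: `siteT`, `siteTransportLaws0_of_regular`), `Support/NestedContourTransportBound` (leaf-06, row B3.b-conc (ii): `theta0`,
`thetaC_le_theta0_div`), `Support/RegularBackgroundTower` (leaf-03, row B5: `matrixBounds_of_regular_of_localRate`,
`norm_connTower_le`, `connTower_lipschitz`), `Support/NE2FromNE3` (owner, row B6: `consistent_of_localRate_lev`).

WHAT THIS FILE DOES (bookkeeping, model level).
* §1 **`connectionLaws0_of_regular`**: row B4.e's connection data shape `ConnectionLaws0 L M Rg α β (βNE3 C) (ζ_R)` for SITE-based bond
  transporters `Rg` READ OFF row B5's class of the lifted transporters `liftR L M Rg` and node NE3's `LocalRate` on `{w, Dw}` (the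
  scalar connection / zeroth-order field at `x` ARE the lifted ones at `(x, κ₀)`, definitionally; two-level constants `βNE3 = 2·card o·C`
  and `zetaR o d α β C = d(2α(βNE3 + β) + 2βNE3)` from leaf-03's `matrixBounds_of_regular_of_localRate`).
* §2 `thetaR_le_geom` (the numeric bound `thetaR … ≤ θ₀·L^{−k}`, `θ₀ = theta0 d α βNE3`, from leaf-06's `thetaC_le_theta0_div`) and
  **`perturbationLaws_gaugeSlot_regular`**: the gauge slot `P₄ = gaugeSlot Rg (QuT (siteT Rg)) Q1 a′` in the target shape with
  `κ₄ = kappa4F d a a′ α β`, `C₄ = C4F …`, from leaf-05's `perturbationLaws_gaugeSlot_data` fed by leaf-04's hypothesis-free scalar tower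
  (`KroneckerLift.freeTowerLaws_kron o (freeTowerLaws_king_scalar …)`), §1, leaf-03's `siteTransportLaws0_of_regular` (`τ = tauR d α =
  e^{(d+1)α} − 1`, `τ′ = θ₀`) and the two numeric inequalities `kappaS d a′ α β τ_R < 1`, `σ₀⁻²·δK < 1`.
* §3 **`perturbationLaws_balaban_final`** / **`balaban_final_rate_of_small`**: leaf-03's sharp tier-B theorems with
  `hE := NE2BalabanWiring.averagingLaws_Ecov_of_regular` and `hP₄ :=` §2.  ROOT B for Bałaban's typed operator
  `Δ_a ⊗ 1 + [covariant Laplacian − Laplacian ⊗ 1] + a·n_k^d·[Q(U)ᴴQ(U) − (QᴴQ) ⊗ 1] − [gauge term]` on ONE site-based background `Rg` with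
  Bałaban's site transports `siteT L M Rg` and mass `a′` now DISPLAYS ONLY: `hreg : RegularTransporters L M (liftR L M Rg) α β` (row B5's
  (3.35)-shape class, c3), `hNE3 : LocalRate (bgReadings L M (regClass L M (liftR L M Rg))) C L⁻¹` (node NE3 BY NAME, OPEN, c2/c7) (the
  numeric bound on the contour-transporter consistency `thetaR` is DISCHARGED in §2 by leaf-06's `thetaC_le_theta0_div`), `0 < a′`, `kappaS … < 1`,
  `σ₀⁻²·δK < 1`, and the small-field threshold `α, β, epsR o d α, κ₄ ≤ η ≤ 1`, `η·KstarR(card o, d, a) < 1`; the site transports are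
  Bałaban's `siteT L M Rg` (transport along the (1.7) legs, leaf-03's `RegularSiteTransporters` / `RegularSiteTransportLaws`, whose
  `siteTransportLaws0_of_regular` discharges row B4.e's `SiteTransportLaws0` shape from `hreg`, `hNE3`).

HONEST FRAMING (T4-DAG p. 1).  Re-assembly BY NAME at MODEL LEVEL: `Rg`, `a′` are DATA; `RegularTransporters`, `LocalRate` are
hypothesis SHAPES; no assertion that `Rg` is Bałaban's minimiser `U_k(V)` (no B0, c5); `siteT Rg` is the (3.19)/(1.7)-SHAPED site transport
built from `Rg`, not a claim about [B9]'s `R(U(Γ))` beyond the shape; GLOBAL small field; finite torus, linear layer, operator norm.  ROOT B is CONDITIONAL on node NE3 (OPEN) and the displayed data;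
NOT [B9] (3.23)–(3.26) as printed; NE2 (U1a) is NOT PROVED by this file (c1 with the carver); spine PROVED count 0/9 unchanged; NOT
infinite volume / mass gap / Clay.  HONEST DEPENDENCY: continuum YM on T⁴ ⇐ BetaPertH ∧ nine spine estimates (0/9 proved); BetaPertH ⇐
(D1) ∧ (D4) ∧ CAP+tail; G-an2-4 gates asym, D1 and NE2/3/4.  ABSOLUTE RULE: no internally-minted statement enters as a cited fact; every
`[cite:]` tag below is a SHAPE locator; no `def … : Prop` fact; no `sorry`.
-/

noncomputable section

open scoped BigOperators ComplexConjugate Matrix Matrix.Norms.L2Operator Kronecker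
open Filter Topology

namespace Summit.QuantumFields.BalabanUV.T4Continuum.NE2BalabanFinal

open Literature.MathematicalPhysics.QuantumFieldTheory.Balaban1983to89.B5Prop11Plancherel (Cst Cst_nonneg Tor fine unitVec)
open Literature.MathematicalPhysics.QuantumFieldTheory.Balaban1983to89.B5G183RateUnitTower (lev lev_neZero)
open Literature.MathematicalPhysics.QuantumFieldTheory.Balaban1983to89.T4EtaRateMin (LocalRate)
open Summit.QuantumFields.BalabanUV.T4Continuum
open Summit.QuantumFields.BalabanUV.T4Continuum.CovariantAveragingTower (TowerLimitRate)
open Summit.QuantumFields.BalabanUV.T4Continuum.BalabanAveragedTowerUnit (idx Qlev)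
open Summit.QuantumFields.BalabanUV.T4Continuum.BackgroundResolventTower
open Summit.QuantumFields.BalabanUV.T4Continuum.KingPairingPlantedLaw
open Summit.QuantumFields.BalabanUV.T4Continuum.KroneckerLift (freeTowerLaws_kron)
open Summit.QuantumFields.BalabanUV.T4Continuum.PerturbationAlgebra
open Summit.QuantumFields.BalabanUV.T4Continuum.BalabanAveragedTowerModes (par)
open Summit.QuantumFields.BalabanUV.T4Continuum.GramPerturbationLaw (AveragingLaws C2gram)
open Summit.QuantumFields.BalabanUV.T4Continuum.NE2FromNE3 (bgReadings consistent_of_localRate_lev)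
open Summit.QuantumFields.BalabanUV.T4Continuum.ColourCovariantLaplacian (zfieldC)
open Summit.QuantumFields.BalabanUV.T4Continuum.RegularBackgroundTower
open Summit.QuantumFields.BalabanUV.T4Continuum.CovariantBlockAveraging (Ecov)
open Summit.QuantumFields.BalabanUV.T4Continuum.CovariantAveragingSummand (kappaQ)
open Summit.QuantumFields.BalabanUV.T4Continuum.GaugeTermPerturbationLaw (deltaK)
open Summit.QuantumFields.BalabanUV.T4Continuum.GaugeTermScalarData (QuT Q1)
open Summit.QuantumFields.BalabanUV.T4Continuum.GaugeTermInstanceGeom (gS kappaGS C4S)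
open Summit.QuantumFields.BalabanUV.T4Continuum.GaugeTermBalabanData (perturbationLaws_gaugeSlot_data)
open Summit.QuantumFields.BalabanUV.T4Continuum.ScalarAveragedPropagator (gammaPs)
open Summit.QuantumFields.BalabanUV.T4Continuum.ScalarAveragedCompression (sigma0)
open Summit.QuantumFields.BalabanUV.T4Continuum.ScalarCovariantLaplacian (connS zfieldS kappaS)
open Summit.QuantumFields.BalabanUV.T4Continuum.ScalarCovariantLaplacianLaws (ConnectionLaws0 SiteTransportLaws0 C2S)
open Summit.QuantumFields.BalabanUV.T4Continuum.EffectiveLaplacianExcess (CX freeTowerLaws_king_scalar)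
open Summit.QuantumFields.BalabanUV.T4Continuum.NestedContourTransport (theta0 thetaC_le_theta0_div)
open Summit.QuantumFields.BalabanUV.T4Continuum.RegularSiteTransporters (siteT)
open Summit.QuantumFields.BalabanUV.T4Continuum.RegularSiteTransportLaws (siteTransportLaws0_of_regular)
open Summit.QuantumFields.BalabanUV.T4Continuum.BalabanAveragedTowerUnit (one_le_lev' cast_lev')
open Summit.QuantumFields.BalabanUV.T4Continuum.NE2BalabanLayer
open Summit.QuantumFields.BalabanUV.T4Continuum.NE2BalabanRoot
open Summit.QuantumFields.BalabanUV.T4Continuum.NE2BalabanGauge (gaugeSlot liftR)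
open Summit.QuantumFields.BalabanUV.T4Continuum.NE2BalabanLayerSharp
open Summit.QuantumFields.BalabanUV.T4Continuum.NE2BalabanWiring

variable {d : ℕ} (L : ℕ) [NeZero L] (M : Fin d → ℕ) [hM : ∀ μ, NeZero (M μ)] (a : ℝ) (ha : 0 < a)
variable {o : Type*} [Fintype o] [DecidableEq o]

/-! ## §1 Row B4.e's connection data shape from row B5's class and node NE3 -/

/-- the two-level constant of the scalar zeroth-order field read off the class and NE3: `ζ_R = d(2α(βNE3 + β) + 2βNE3)`
(`RegularBackgroundTower.boundedBackgroundM_of_regular` with `βc = βD = βNE3`). [folklore] -/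
def zetaR (o : Type*) [Fintype o] (d : ℕ) (α β C : ℝ) : ℝ := d * (2 * α * (betaNE3 o C + β) + 2 * betaNE3 o C)

omit [NeZero L] hM [Fintype o] in
/-- the scalar connection at the site `x` IS the lifted connection tower at `(x, κ)` (definitional). [folklore] -/
theorem connS_eq_connTower (Rg : (k : ℕ) → Fin d → (Tor (fine (lev L k) M) → Matrix o o ℂ)) (k : ℕ) (μ : Fin d)
    (x : Tor (fine (lev L k) M)) (κ : Fin d) :
    connS (fine (lev L k) M) ((lev L k : ℕ) : ℂ) (Rg k) μ x = connTower L M (liftR L M Rg) k μ (x, κ) := rfl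

omit [NeZero L] hM in
/-- the scalar zeroth-order field at the site `x` IS the lifted `zfieldC` at `(x, κ)` (definitional). [folklore] -/
theorem zfieldS_eq_zfieldC (Rg : (k : ℕ) → Fin d → (Tor (fine (lev L k) M) → Matrix o o ℂ)) (k : ℕ) (x : Tor (fine (lev L k) M))
    (κ : Fin d) :
    zfieldS (fine (lev L k) M) ((lev L k : ℕ) : ℂ) (Rg k) x = zfieldC (fine (lev L k) M) ((lev L k : ℕ) : ℂ) (liftR L M Rg k) (x, κ) := rfl

/-- **ROW B4.e's `ConnectionLaws0` FROM ROW B5's CLASS AND NODE NE3 BY NAME** (`d ≥ 1`): for site-based bond transporters `Rg` whose lift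
`liftR L M Rg` lies in the (3.35)-shape class with sizes `α, β` and whose coefficient towers `{w, Dw}` obey node NE3's `LocalRate … C L⁻¹`,
the scalar layer's connection data hold with `β′ = βNE3 = 2·card o·C` and `ζ = zetaR o d α β C`.  `hNE3` is a displayed binder (node NE3
OPEN); nothing about Bałaban's minimisers is asserted. [folklore] -/
theorem connectionLaws0_of_regular (hd : 1 ≤ d) {Rg : (k : ℕ) → Fin d → (Tor (fine (lev L k) M) → Matrix o o ℂ)} {α β : ℝ}
    (hreg : RegularTransporters L M (liftR L M Rg) α β) {C : ℝ} (hC : 0 ≤ C)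
    (hNE3 : LocalRate (bgReadings L M (regClass L M (liftR L M Rg))) C ((L : ℝ)⁻¹)) :
    ConnectionLaws0 L M Rg α β (betaNE3 o C) (zetaR o d α β C) := by
  set κ₀ : Fin d := ⟨0, hd⟩
  obtain ⟨hα, hβ⟩ := hreg.nonneg
  have hb : 0 ≤ betaNE3 o C := by unfold betaNE3; positivity
  have hw := consistent_of_localRate_lev L M hC hNE3 (Set.mem_insert _ _ : connTower L M (liftR L M Rg) ∈ regClass L M (liftR L M Rg))
  have hz := (matrixBounds_of_regular_of_localRate L M hreg hC hNE3).2
  refine ⟨⟨hα, hβ, hb, by unfold zetaR; positivity⟩, fun k μ x => ?_, fun k μ ν x => ?_, fun k μ x' => ?_, fun k x' => ?_⟩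
  · rw [connS_eq_connTower L M Rg k μ x κ₀]
    exact norm_connTower_le hreg k μ (x, κ₀)
  · rw [connS_eq_connTower L M Rg k μ _ κ₀, connS_eq_connTower L M Rg k μ x κ₀]
    exact connTower_lipschitz hreg k μ ν (x, κ₀)
  · rw [connS_eq_connTower L M Rg (k + 1) μ x' κ₀, connS_eq_connTower L M Rg k μ _ κ₀]
    have h := hw k μ (x', κ₀)
    rwa [betaNE3]
  · rw [zfieldS_eq_zfieldC L M Rg (k + 1) x' κ₀, zfieldS_eq_zfieldC L M Rg k _ κ₀]
    exact hz.consistent k (x', κ₀)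

/-! ## §2 The numeric transporter bound and the gauge slot on row data -/

/-- the size `τ_R = e^{(d+1)α} − 1` of Bałaban's site transports along the (1.7) legs (leaf-03's `norm_siteT_sub_one_le`). [folklore] -/
def tauR (d : ℕ) (α : ℝ) : ℝ := Real.exp ((d + 1 : ℕ) * α) - 1

omit hM [DecidableEq o] in
/-- **THE NUMERIC BOUND `hθg` DISCHARGED** (leaf-06's `thetaC_le_theta0_div`, row B3.b-conc (ii)): `thetaR o d L α C k ≤ θ₀(d, α, βNE3)·L^{−k}`.
[folklore] -/
theorem thetaR_le_geom {α C : ℝ} (hα : 0 ≤ α) (hC : 0 ≤ C) (k : ℕ) :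
    thetaR o d L α C k ≤ theta0 d α (betaNE3 o C) * ((L : ℝ)⁻¹) ^ k := by
  have hb : 0 ≤ betaNE3 o C := by unfold betaNE3; positivity
  have h := thetaC_le_theta0_div (L := L) (n := lev L k) (Nat.pos_of_ne_zero (NeZero.ne L)) (one_le_lev' L k) d hα hb
  unfold thetaR
  refine h.trans (le_of_eq ?_)
  rw [cast_lev', div_eq_mul_inv, inv_pow]

/-- the scalar tower's complement-defect constant `C₀ = 2d√(γ′⁻¹)` (`freeTowerLaws_king_scalar`). [folklore] -/
def C0S (d : ℕ) (a' : ℝ) : ℝ := 2 * d * Real.sqrt ((gammaPs d a')⁻¹)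

/-- **`κ₄` OF THE GAUGE SLOT ON ROW DATA**: `kappaGS d a a′ (kappaS d a′ α β τ_R) α τ_R`, `τ_R = tauR d α`. [folklore] -/
def kappa4F (d : ℕ) (a a' α β : ℝ) : ℝ := kappaGS d a a' (kappaS d a' α β (tauR d α)) α (tauR d α)

/-- **`C₄` OF THE GAUGE SLOT ON ROW DATA**: leaf-05's `C4S` at the scalar tower's defects `C₀ = 2d√(γ′⁻¹)`, `C₁ = C₀ + C_X(d, a′)`, row
B4.e's `C2S` with `β′ = βNE3`, `ζ = zetaR`, `τ = τ_R`, `τ′ = θ₀(d, α, βNE3)`. [folklore] -/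
def C4F (o : Type*) [Fintype o] (d L : ℕ) (a a' α β C : ℝ) : ℝ :=
  C4S d L a a' (kappaS d a' α β (tauR d α)) α β (betaNE3 o C) (tauR d α) (C0S d a') (C0S d a' + CX d a')
    (C2S d L a' α β (betaNE3 o C) (zetaR o d α β C) (tauR d α) (theta0 d α (betaNE3 o C)) (C0S d a') (C0S d a' + CX d a'))
    (theta0 d α (betaNE3 o C))

/-- **THE GAUGE SLOT IN THE TARGET SHAPE FROM THE CLASS, NODE NE3 AND THE HYPOTHESIS-FREE SCALAR TOWER** (`d ≥ 1`, `a′ > 0`): for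
Bałaban's site transports `siteT L M Rg` (transport along the (1.7) legs, leaf-03) and block averaging `QuT … (siteT …)`,
`PerturbationLaws (Δ_a ⊗ 1) (gaugeSlot Rg (QuT (siteT Rg)) Q1 a′) (J ⊗ 1) κ₄ (C₄·L^{−k})`, `κ₄ = kappa4F d a a′ α β`, `C₄ = C4F …` — leaf-05's
`perturbationLaws_gaugeSlot_data` with `hfree := freeTowerLaws_kron o (freeTowerLaws_king_scalar …)` (leaf-04, row B4.d END),
`hR := connectionLaws0_of_regular` (§1) and `hT := siteTransportLaws0_of_regular` (leaf-03).  Displayed: `hreg`, `hNE3`, the numeric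
`kappaS … < 1`, `σ₀⁻²·δK < 1`.  NE2 is NOT proved by this. [cite: Balaban1985BackgroundPropagators, (3.19) p.393, (3.25) p.394, (3.26) p.395
(shapes)] [folklore] -/
theorem perturbationLaws_gaugeSlot_regular (hd : 1 ≤ d) {Rg : (k : ℕ) → Fin d → (Tor (fine (lev L k) M) → Matrix o o ℂ)}
    {α β : ℝ} (hreg : RegularTransporters L M (liftR L M Rg) α β) {C : ℝ} (hC : 0 ≤ C)
    (hNE3 : LocalRate (bgReadings L M (regClass L M (liftR L M Rg))) C ((L : ℝ)⁻¹)) {a' : ℝ} (ha' : 0 < a')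
    (hκ : kappaS d a' α β (tauR d α) < 1)
    (hsmall : ((sigma0 d a') ^ 2)⁻¹ * deltaK (gS d a' (kappaS d a' α β (tauR d α))) (1 + tauR d α) (d * α) (tauR d α) a' < 1) :
    PerturbationLaws (fun k => calDalev L M a ha k ⊗ₖ (1 : Matrix o o ℂ))
      (gaugeSlot L M Rg (QuT L M o (siteT L M Rg)) (Q1 L M o) a')
      (fun k => JpcT L M k ⊗ₖ (1 : Matrix o o ℂ)) (kappa4F d a a' α β)
      (fun k => C4F o d L a a' α β C * ((L : ℝ)⁻¹) ^ k) :=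
  perturbationLaws_gaugeSlot_data L M a ha hd ha'
    (freeTowerLaws_kron o (freeTowerLaws_king_scalar L M (Nat.lt_of_lt_of_le Nat.zero_lt_one hd) ha'))
    (fun _ => le_rfl) (fun _ => le_rfl) (connectionLaws0_of_regular L M hd hreg hC hNE3)
    (siteTransportLaws0_of_regular L M hd hreg hC hNE3) hκ hsmall

/-! ## §3 ROOT B on row data -/

/-- **ROW B7 FINAL — `PerturbationLaws` FOR BAŁABAN's TYPED OPERATOR ON ROW DATA** (`d ≥ 1`): the target shape for
`balabanPert (liftR Rg) (gaugeSlot Rg (QuT (siteT Rg)) Q1 a′)` with `κ = kappaBs o d a α β (kappaQ d a a (epsR o d α)) (kappa4F …)`,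
`C₂ = C2Bs o d L a α β C (a·C2gram … (epsR …) … (CdeltaR o d a α θ₀)) (C4F …)`, `θ₀ = theta0 d α βNE3` — leaf-03's
`perturbationLaws_balaban_sharp` with `hE := averagingLaws_Ecov_of_regular … thetaR_le_geom` and `hP₄ := perturbationLaws_gaugeSlot_regular`.
DISPLAYED BINDERS ONLY: `hreg` (row B5's (3.35)-shape class, c3), `hNE3` (node NE3 BY NAME, OPEN, c2/c7), `0 < a′`, and the numeric
`kappaS … < 1`, `σ₀⁻²·δK < 1` (c4).  NE2 is NOT proved by this. [cite: Balaban1985BackgroundPropagators, (3.26) p.395 (shape)] [folklore] -/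
theorem perturbationLaws_balaban_final (hd : 1 ≤ d) {Rg : (k : ℕ) → Fin d → (Tor (fine (lev L k) M) → Matrix o o ℂ)}
    {α β : ℝ} (hreg : RegularTransporters L M (liftR L M Rg) α β) {C : ℝ} (hC : 0 ≤ C)
    (hNE3 : LocalRate (bgReadings L M (regClass L M (liftR L M Rg))) C ((L : ℝ)⁻¹)) {a' : ℝ} (ha' : 0 < a')
    (hκ : kappaS d a' α β (tauR d α) < 1)
    (hsmall : ((sigma0 d a') ^ 2)⁻¹ * deltaK (gS d a' (kappaS d a' α β (tauR d α))) (1 + tauR d α) (d * α) (tauR d α) a' < 1) :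
    PerturbationLaws (fun k => calDalev L M a ha k ⊗ₖ (1 : Matrix o o ℂ))
      (balabanPert L M a (liftR L M Rg) (gaugeSlot L M Rg (QuT L M o (siteT L M Rg)) (Q1 L M o) a'))
      (fun k => JpcT L M k ⊗ₖ (1 : Matrix o o ℂ))
      (kappaBs o d a α β (kappaQ d a (a : ℂ) (epsR o d α)) (kappa4F d a a' α β))
      (fun k => C2Bs o d L a α β C
        (a * C2gram (Cst d a) 1 (epsR o d α) (2 * d * Cst d a) (CJ d a) (Cst d a) (CdeltaR o d a α (theta0 d α (betaNE3 o C))))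
        (C4F o d L a a' α β C) * ((L : ℝ)⁻¹) ^ k) :=
  perturbationLaws_balaban_sharp L M a ha hd hreg hC hNE3 (epsR_nonneg (o := o) (d := d) hreg.nonneg.1)
    (averagingLaws_Ecov_of_regular L M a ha hreg hC hNE3 (thetaR_le_geom L (o := o) (d := d) hreg.nonneg.1 hC))
    (perturbationLaws_gaugeSlot_regular L M a ha hd hreg hC hNE3 ha' hκ hsmall)

/-- **ROW B7 FINAL — ROOT B AT `t = 1` ON ROW DATA, SHARP EXPLICIT THRESHOLD** (`L ≥ 2`, `d ≥ 1`): for site-based bond transporters `Rg`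
in row B5's (3.35)-shape class (`α, β`) whose coefficient towers `{w, Dw}` obey NODE NE3's `LocalRate … C L⁻¹` (BY NAME, OPEN), mass
`a′ > 0`, and NUMBERS with `kappaS d a′ α β τ_R < 1`, `σ₀⁻²·δK < 1`, `α, β, epsR o d α, kappa4F … ≤ η ≤ 1`, `η·KstarR(card o, d, a) < 1`:
the lifted King-averaged unit-lattice covariances of `(Δ_a^{(k)} ⊗ 1 + P_k)⁻¹`, `P` the model of `Δ_a(U) − Δ_a ⊗ 1` (covariant Laplacian
+ Bałaban's covariant line-sum averaging + gauge term with site transports along the (1.7) legs), CONVERGE with rate `L^{−k}`.  Every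
operator-level input of the skeleton (rows B2–B6) is consumed BY NAME; model level (no B0); NOT [B9] (3.23)–(3.26) as printed; NE2 (U1a)
is NOT proved by this (c1). [folklore] -/
theorem balaban_final_rate_of_small (hL : 2 ≤ L) (hd : 1 ≤ d)
    {Rg : (k : ℕ) → Fin d → (Tor (fine (lev L k) M) → Matrix o o ℂ)}
    {α β : ℝ} (hreg : RegularTransporters L M (liftR L M Rg) α β) {C : ℝ} (hC : 0 ≤ C)
    (hNE3 : LocalRate (bgReadings L M (regClass L M (liftR L M Rg))) C ((L : ℝ)⁻¹)) {a' : ℝ} (ha' : 0 < a')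
    (hκ : kappaS d a' α β (tauR d α) < 1)
    (hsmall : ((sigma0 d a') ^ 2)⁻¹ * deltaK (gS d a' (kappaS d a' α β (tauR d α))) (1 + tauR d α) (d * α) (tauR d α) a' < 1)
    {η : ℝ} (hαη : α ≤ η) (hβη : β ≤ η) (hεη : epsR o d α ≤ η) (hκη : kappa4F d a a' α β ≤ η) (hη1 : η ≤ 1)
    (hηK : η * KstarR o d a < 1) :
    TowerLimitRate (fun k => Qlev L M k ⊗ₖ (1 : Matrix o o ℂ)) ((L : ℝ) ^ d)
      (fun k => (calDalev L M a ha k ⊗ₖ (1 : Matrix o o ℂ)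
        + balabanPert L M a (liftR L M Rg) (gaugeSlot L M Rg (QuT L M o (siteT L M Rg)) (Q1 L M o) a') k)⁻¹)
      (Cpert (kappaBs o d a α β (a * (epsR o d α * (2 + epsR o d α) * Cst d a)) (kappa4F d a a' α β))
        (2 * d * Cst d a) (CJ d a)
        (C2Bs o d L a α β C
          (a * C2gram (Cst d a) 1 (epsR o d α) (2 * d * Cst d a) (CJ d a) (Cst d a) (CdeltaR o d a α (theta0 d α (betaNE3 o C))))
          (C4F o d L a a' α β C)) 0 1) ((L : ℝ)⁻¹) :=
  balaban_rate_of_small_sharp L M a ha hL hd hreg hC hNE3 (epsR_nonneg (o := o) (d := d) hreg.nonneg.1)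
    (averagingLaws_Ecov_of_regular L M a ha hreg hC hNE3 (thetaR_le_geom L (o := o) (d := d) hreg.nonneg.1 hC))
    (perturbationLaws_gaugeSlot_regular L M a ha hd hreg hC hNE3 ha' hκ hsmall) hαη hβη hεη hκη hη1 hηK

end Summit.QuantumFields.BalabanUV.T4Continuum.NE2BalabanFinal

end
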